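import Summits.Ventures.PercRepro.ProfilePointedCircuitClassesStarSharpPencilK

/-!
# PercRepro — THE PENCIL THROUGH `ℓ ∈ X`, PART L: THE COUNTING LEMMA AND THE REGIME THEOREM
(p5, gen 56; `proofs/P5-GM1.md` §83)

`pencilX_card_bad_le`: the bad demands of the pencil through `ℓ ∈ X` (`b` generic, `ρ{e, ℓ, b, b′} = 3`,
`ρ{e, f, ℓ} = 3`) are at most the C-targets of the fourth and fifth kinds plus the free bi-bases of the third kind —
the three classes N (`c1`, `ℓ ∈ π`), X (`c1`, `ℓ ∉ π`), F (`¬c1`) against the three target classes of parts C–K.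
`inCount_thru_le_of_pencil_X`: the `b′`-avoiding inequality in the pencil through `ℓ ∈ X` (the assembly of D0R with
the third kind split by the image of `d0_injR2''`).
-/

open scoped Matroid

namespace PercRepro.Cogirth

open Finset ThmH Skew Shadow Profile

open Classical

variable {α : Type} [DecidableEq α] {N : Matroid α} [N.Finite]

section StarSharpPencilL

variable {b b' : α}

/-- The pencil through `ℓ ∈ X`, assembled from the counting lemma `hbad`. -/
theorem inCount_thru_le_of_pencil_X_of_count (hn : (gr N).card = 9) (h : SeriesPair N b b')
    {e f : α} (he : e ∈ gr N) (hf : f ∈ gr N) (hef : e ≠ f) (heb : e ≠ b) (heb' : e ≠ b') (hfb : f ≠ b) (hfb' : f ≠ b')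
    (hbad : ((d0DON N b' e f).filter (fun W => ¬ d0c0 N b b' e f W ∧ ¬ (d0c1 N b e f W ∧ d0c2 N b b' e f W))).card ≤
      ((biIndepSets N 4).filter (fun W => (f ∈ W ∧ b' ∉ W) ∧
        (e ∈ W ∧ b ∈ W ∧ ¬ (gr N \ W).erase b' ∈ biIndepSets N 4))).card +
      ((biIndepSets N 4).filter (fun W => (f ∈ W ∧ b' ∉ W) ∧
        (e ∈ W ∧ b ∈ W ∧ (gr N \ W).erase b' ∈ biIndepSets N 4))).card +
      ((biIndepSets N 4).filter (fun B => ((f ∈ B ∧ b' ∉ B) ∧ (e ∈ B ∧ b ∉ B)) ∧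
        ¬ (insert b (B.erase f) ∈ biIndepSets N 4 ∧ rk N (insert b (insert b' (B.erase f))) = 4))).card) :
    inCount N 4 e + thruCount N 4 {b', f} + thruCount N 4 {b', e, f} ≤
      inCount N 4 f + thruCount N 4 {e, f} + thruCount N 4 {b', e} := by
  -- THE ASSEMBLY (as in D0R)
  rw [inCount_thru_split']
  have hsplit := card_filter_add_card_filter_not (s := (biIndepSets N 4).filter (fun W => (e ∈ W ∧ f ∉ W) ∧ b' ∉ W))
    (fun W => (gr N \ W).erase b' ∈ biIndepSets N 4)
  simp only [filter_filter] at hsplit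
  have htar : ((biIndepSets N 4).filter (fun W => (f ∈ W ∧ b' ∉ W) ∧ (e ∉ W ∧ (gr N \ W).erase b' ∈ biIndepSets N 4))).card +
      ((biIndepSets N 4).filter (fun W => (f ∈ W ∧ b' ∉ W) ∧ (e ∉ W ∧ b ∈ W ∧ ¬ (gr N \ W).erase b' ∈ biIndepSets N 4))).card +
      ((biIndepSets N 4).filter (fun W => (f ∈ W ∧ b' ∉ W) ∧ (e ∈ W ∧ b ∉ W))).card +
      ((biIndepSets N 4).filter (fun W => (f ∈ W ∧ b' ∉ W) ∧ (e ∈ W ∧ b ∈ W ∧ ¬ (gr N \ W).erase b' ∈ biIndepSets N 4))).card +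
      ((biIndepSets N 4).filter (fun W => (f ∈ W ∧ b' ∉ W) ∧ (e ∈ W ∧ b ∈ W ∧ (gr N \ W).erase b' ∈ biIndepSets N 4))).card ≤
      ((biIndepSets N 4).filter (fun W => f ∈ W ∧ b' ∉ W)).card := by
    rw [← card_union_of_disjoint, ← card_union_of_disjoint, ← card_union_of_disjoint, ← card_union_of_disjoint]
    · apply card_le_card
      intro W hW
      simp only [mem_union, mem_filter] at hW ⊢
      rcases hW with (((hW | hW) | hW) | hW) | hW <;> exact ⟨hW.1, hW.2.1⟩
    · rw [disjoint_union_left, disjoint_union_left, disjoint_union_left]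
      refine ⟨⟨⟨?_, ?_⟩, ?_⟩, ?_⟩ <;> rw [disjoint_filter]
      · rintro W _ ⟨-, heW, -⟩ ⟨-, heW', -, -⟩; exact heW heW'
      · rintro W _ ⟨-, heW, -, -⟩ ⟨-, heW', -, -⟩; exact heW heW'
      · rintro W _ ⟨-, -, hbW⟩ ⟨-, -, hbW', -⟩; exact hbW hbW'
      · rintro W _ ⟨-, -, -, hc⟩ ⟨-, -, -, hc'⟩; exact hc hc'
    · rw [disjoint_union_left, disjoint_union_left]
      refine ⟨⟨?_, ?_⟩, ?_⟩ <;> rw [disjoint_filter]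
      · rintro W _ ⟨-, heW, -⟩ ⟨-, heW', -, -⟩; exact heW heW'
      · rintro W _ ⟨-, heW, -, -⟩ ⟨-, heW', -, -⟩; exact heW heW'
      · rintro W _ ⟨-, -, hbW⟩ ⟨-, -, hbW', -⟩; exact hbW hbW'
    · rw [disjoint_union_left]
      refine ⟨?_, ?_⟩ <;> rw [disjoint_filter]
      · rintro W _ ⟨-, heW, -⟩ ⟨-, heW', -⟩; exact heW heW'
      · rintro W _ ⟨-, heW, -, -⟩ ⟨-, heW', -⟩; exact heW heW'
    · rw [disjoint_filter]
      rintro W _ ⟨-, -, hc⟩ ⟨-, -, -, hc'⟩; exact hc' hc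
  have hinj1 := card_off_demands_le (N := N) (b' := b') (e := e) hf hfb'
  have hs1 := card_filter_add_card_filter_not (s := d0DON N b' e f) (fun W => d0c0 N b b' e f W)
  have hs2 := card_filter_add_card_filter_not (s := (d0DON N b' e f).filter (fun W => ¬ d0c0 N b b' e f W))
    (fun W => d0c1 N b e f W ∧ d0c2 N b b' e f W)
  simp only [filter_filter] at hs2
  have hshape : (d0DON N b' e f).filter (fun W => ¬ d0c0 N b b' e f W ∧ (d0c1 N b e f W ∧ d0c2 N b b' e f W)) =
      (d0DON N b' e f).filter (fun W => (¬ d0c0 N b b' e f W ∧ d0c1 N b e f W) ∧ d0c2 N b b' e f W) :=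
    filter_congr (fun W _ => and_assoc.symm)
  rw [hshape] at hs2
  have hinjR0 := d0_injR0 h hn he hf hef heb heb' hfb hfb'
  have hinjR2 := d0_injR2'' hn h he hf hef heb heb' hfb hfb'
  have hsB := card_filter_add_card_filter_not
    (s := (biIndepSets N 4).filter (fun W => (f ∈ W ∧ b' ∉ W) ∧ (e ∈ W ∧ b ∉ W)))
    (fun B => insert b (B.erase f) ∈ biIndepSets N 4 ∧ rk N (insert b (insert b' (B.erase f))) = 4)
  simp only [filter_filter] at hsB
  have hDON : (d0DON N b' e f).card = ((biIndepSets N 4).filter (fun W => ((e ∈ W ∧ f ∉ W) ∧ b' ∉ W) ∧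
      ¬ (gr N \ W).erase b' ∈ biIndepSets N 4)).card := rfl
  rw [← hDON] at hsplit
  have hs2' : ((d0DON N b' e f).filter (fun W => (¬ d0c0 N b b' e f W ∧ d0c1 N b e f W) ∧ d0c2 N b b' e f W)).card +
      ((d0DON N b' e f).filter (fun W => ¬ d0c0 N b b' e f W ∧ ¬ (d0c1 N b e f W ∧ d0c2 N b b' e f W))).card =
      ((d0DON N b' e f).filter (fun W => ¬ d0c0 N b b' e f W)).card := by
    rw [← hs2]
  have hsum := Nat.add_le_add hinjR0 (Nat.add_le_add hinjR2 hbad)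
  omega

/-- **THE COUNTING LEMMA OF THE PENCIL THROUGH `ℓ ∈ X`**: bad demands ≤ ON C-targets + OFF C-targets + free
bi-bases. -/
theorem pencilX_card_bad_le (hn : (gr N).card = 9) (hR : rk N (gr N) = 5) (h : SeriesPair N b b') {e f : α}
    (he : e ∈ gr N) (hf : f ∈ gr N) (hef : e ≠ f) (heb : e ≠ b) (heb' : e ≠ b') (hfb : f ≠ b) (hfb' : f ≠ b')
    (he1 : ∀ y ∈ ((((gr N).erase b).erase b').erase f).erase e, rk N {e, y} = 2)
    (hf1 : ∀ y ∈ ((((gr N).erase b).erase b').erase f).erase e, rk N {f, y} = 2)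
    (hfc : ∀ y ∈ ((((gr N).erase b).erase b').erase f).erase e, rk N (((((gr N).erase b).erase b').erase f).erase y) = 4)
    (hX : rk N (((((gr N).erase b).erase b').erase f).erase e) = 4) (hef2 : rk N {e, f} = 2)
    (heb3 : rk N {e, b, b'} = 3)
    (hbg : ∀ y ∈ ((((gr N).erase b).erase b').erase f).erase e, rk N {y, b, b'} = 3)
    {l : α} (hlX : l ∈ ((((gr N).erase b).erase b').erase f).erase e) (hlon : rk N (insert b (insert b' {e, l})) = 3)
    (hefl : rk N {e, f, l} = 3) :
    ((d0DON N b' e f).filter (fun W => ¬ d0c0 N b b' e f W ∧ ¬ (d0c1 N b e f W ∧ d0c2 N b b' e f W))).card ≤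
      ((biIndepSets N 4).filter (fun W => (f ∈ W ∧ b' ∉ W) ∧
        (e ∈ W ∧ b ∈ W ∧ ¬ (gr N \ W).erase b' ∈ biIndepSets N 4))).card +
      ((biIndepSets N 4).filter (fun W => (f ∈ W ∧ b' ∉ W) ∧
        (e ∈ W ∧ b ∈ W ∧ (gr N \ W).erase b' ∈ biIndepSets N 4))).card +
      ((biIndepSets N 4).filter (fun B => ((f ∈ B ∧ b' ∉ B) ∧ (e ∈ B ∧ b ∉ B)) ∧
        ¬ (insert b (B.erase f) ∈ biIndepSets N 4 ∧ rk N (insert b (insert b' (B.erase f))) = 4))).card := by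
  -- the bad demands by `c1`, then by `ℓ ∈ W`
  have hs1 := card_filter_add_card_filter_not
    (s := (d0DON N b' e f).filter (fun W => ¬ d0c0 N b b' e f W ∧ ¬ (d0c1 N b e f W ∧ d0c2 N b b' e f W)))
    (fun W => d0c1 N b e f W)
  simp only [filter_filter] at hs1
  have hs2 := card_filter_add_card_filter_not
    (s := (d0DON N b' e f).filter (fun W => (¬ d0c0 N b b' e f W ∧ ¬ (d0c1 N b e f W ∧ d0c2 N b b' e f W)) ∧
      d0c1 N b e f W)) (fun W => l ∈ W)
  simp only [filter_filter] at hs2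
  have hsN : ((d0DON N b' e f).filter (fun W => ((¬ d0c0 N b b' e f W ∧ ¬ (d0c1 N b e f W ∧ d0c2 N b b' e f W)) ∧
      d0c1 N b e f W) ∧ l ∈ W)).card =
      ((d0DON N b' e f).filter (fun W => (¬ d0c0 N b b' e f W ∧ ¬ (d0c1 N b e f W ∧ d0c2 N b b' e f W)) ∧
      (d0c1 N b e f W ∧ l ∈ W))).card := by
    congr 1; exact filter_congr (fun W _ => and_assoc)
  have hsX : ((d0DON N b' e f).filter (fun W => ((¬ d0c0 N b b' e f W ∧ ¬ (d0c1 N b e f W ∧ d0c2 N b b' e f W)) ∧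
      d0c1 N b e f W) ∧ l ∉ W)).card =
      ((d0DON N b' e f).filter (fun W => (¬ d0c0 N b b' e f W ∧ ¬ (d0c1 N b e f W ∧ d0c2 N b b' e f W)) ∧
      (d0c1 N b e f W ∧ l ∉ W))).card := by
    congr 1; exact filter_congr (fun W _ => and_assoc)
  -- the C-targets: the two kinds together, then by `ℓ` off `P_f`
  have ht1 := card_filter_add_card_filter_not
    (s := (biIndepSets N 4).filter (fun W => (f ∈ W ∧ b' ∉ W) ∧ (e ∈ W ∧ b ∈ W)))
    (fun W => (gr N \ W).erase b' ∈ biIndepSets N 4)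
  simp only [filter_filter] at ht1
  have ht1on : ((biIndepSets N 4).filter (fun W => ((f ∈ W ∧ b' ∉ W) ∧ (e ∈ W ∧ b ∈ W)) ∧
      (gr N \ W).erase b' ∈ biIndepSets N 4)).card =
      ((biIndepSets N 4).filter (fun W => (f ∈ W ∧ b' ∉ W) ∧
        (e ∈ W ∧ b ∈ W ∧ (gr N \ W).erase b' ∈ biIndepSets N 4))).card := by
    congr 1; exact filter_congr (fun W _ => by tauto)
  have ht1off : ((biIndepSets N 4).filter (fun W => ((f ∈ W ∧ b' ∉ W) ∧ (e ∈ W ∧ b ∈ W)) ∧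
      ¬ (gr N \ W).erase b' ∈ biIndepSets N 4)).card =
      ((biIndepSets N 4).filter (fun W => (f ∈ W ∧ b' ∉ W) ∧
        (e ∈ W ∧ b ∈ W ∧ ¬ (gr N \ W).erase b' ∈ biIndepSets N 4))).card := by
    congr 1; exact filter_congr (fun W _ => by tauto)
  have ht2 := card_filter_add_card_filter_not
    (s := (biIndepSets N 4).filter (fun W => (f ∈ W ∧ b' ∉ W) ∧ (e ∈ W ∧ b ∈ W)))
    (fun W => rk N (insert l (W.erase b)) = 4)
  simp only [filter_filter] at ht2
  -- the free bi-bases by the X-class predicate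
  have ht3 := card_filter_add_card_filter_not
    (s := (biIndepSets N 4).filter (fun B => ((f ∈ B ∧ b' ∉ B) ∧ (e ∈ B ∧ b ∉ B)) ∧
      ¬ (insert b (B.erase f) ∈ biIndepSets N 4 ∧ rk N (insert b (insert b' (B.erase f))) = 4)))
    (fun B => l ∉ B ∧ ∀ z ∈ (B.erase e).erase f, rk N (insert f (insert e {l, z})) = 4)
  simp only [filter_filter] at ht3
  have hN := pencilX_card_N_le hn hR h he hf hef heb heb' hfb hfb' hf1 hfc heb3 hbg hlX hlon
  have hXc := pencilX_card_X_le hn hR h he hf hef heb heb' hfb hfb' he1 hfc hX heb3 hbg hlX hlon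
  have hF := pencilX_card_F_le hn h he hf hef heb heb' hfb hfb' he1 hf1 hfc hX hef2 heb3 hbg hlX hlon hefl
  omega

/-- **THE PENCIL THROUGH `ℓ ∈ X`**: `b` generic, the line `eℓ` ON (`ρ{e, ℓ, b, b′} = 3`) and `f` off it
(`ρ{e, f, ℓ} = 3`); then the `b′`-avoiding inequality holds. -/
theorem inCount_thru_le_of_pencil_X (hn : (gr N).card = 9) (hR : rk N (gr N) = 5) (h : SeriesPair N b b')
    {e f : α} (he : e ∈ gr N) (hf : f ∈ gr N) (hef : e ≠ f) (heb : e ≠ b) (heb' : e ≠ b') (hfb : f ≠ b) (hfb' : f ≠ b')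
    (he1 : ∀ y ∈ ((((gr N).erase b).erase b').erase f).erase e, rk N {e, y} = 2)
    (hf1 : ∀ y ∈ ((((gr N).erase b).erase b').erase f).erase e, rk N {f, y} = 2)
    (hfc : ∀ y ∈ ((((gr N).erase b).erase b').erase f).erase e, rk N (((((gr N).erase b).erase b').erase f).erase y) = 4)
    (hX : rk N (((((gr N).erase b).erase b').erase f).erase e) = 4) (hef2 : rk N {e, f} = 2)
    (heb3 : rk N {e, b, b'} = 3)
    (hbg : ∀ y ∈ ((((gr N).erase b).erase b').erase f).erase e, rk N {y, b, b'} = 3)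
    {l : α} (hlX : l ∈ ((((gr N).erase b).erase b').erase f).erase e) (hlon : rk N (insert b (insert b' {e, l})) = 3)
    (hefl : rk N {e, f, l} = 3) :
    inCount N 4 e + thruCount N 4 {b', f} + thruCount N 4 {b', e, f} ≤
      inCount N 4 f + thruCount N 4 {e, f} + thruCount N 4 {b', e} :=
  inCount_thru_le_of_pencil_X_of_count hn h he hf hef heb heb' hfb hfb'
    (pencilX_card_bad_le hn hR h he hf hef heb heb' hfb hfb' he1 hf1 hfc hX hef2 heb3 hbg hlX hlon hefl)

end StarSharpPencilL

end PercRepro.Cogirth
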